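import Literature.AlgebraicGeometry.Motives.JacobianPrimeThetaDivisorExists
import Literature.Topology.KrullDimensionDrop
import HarnessLib

/-!
# Lange's Lemma 4.2.1 (ii): `dim W̃_r(P) = r` for every `r ≤ dim J`

Layer `Literature/AlgebraicGeometry/Motives` (namespace `….Motives.Jacobian`).  KERNEL ONLY (theorems; no definition, no named fact, no instance,
no `sorry`).

Lange, *Abelian Varieties over the Complex Numbers* (2023), §4.2.1 Lemma 4.2.1 (ii): for a smooth projective curve `C` of genus `g` and every
`n ≤ g`, the locus `W̃_n = α_{nc}(C^{(n)}) ⊆ J` is an irreducible closed subvariety of dimension `n`; Milne, *Jacobian Varieties*, §5, Thm. 5.1 (a):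
`f^{(r)} : C^{(r)} → W^r` is birational for `r ≤ g`.  ★ p767754 (`Motives/JacobianPrimeThetaDivisorExists`) proves `dim W̃_r(P) = r` GRANTED
the `(r+1)`-fold uniqueness statement and, unconditionally, the case `r = dim J − 1`.  Here the same alteration argument with an extra
`s`-TUPLE in place of one extra point (`Fin.append`, `Fin.prod_univ_add`):

* §1 (any algebraically closed `k`) **`Jacobian.exists_isAlteration_lift_abelSum_of_add`** — granted uniqueness of `n`-fold Abel sums over a
  non-empty open of `J` with `r + s = n`, the Abel sum map `α_r : C^r → J` lifts through the reduced closed subscheme on `W̃_r(P)` to an ALTERATION (the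
  `k`-point fibre of `α_r` over `w` injects, by `z ↦ (coordinates of z) ⧺ ρ`, into the `𝔖_n`-orbit over `w · α_s(ρ)`), hence
  **`Jacobian.topologicalKrullDim_brillNoetherLocus_of_hopen_add`**: `dim W̃_r(P) = r`.
* §2 (smooth projective complex curve, `dim J ≥ 1`) **`Jacobian.topologicalKrullDim_brillNoetherLocus_eq_of_le (𝒥) (hC) (hdim) (P) (hr : r ≤ dim J)`**:
  `dim W̃_r(P) = r` for EVERY `r ≤ dim J`, UNCONDITIONALLY — the `dim J`-fold uniqueness is ★ (γ) `exists_opens_general_abelSum_of_isSmoothProjective`.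
* §3 (ed. 2) Lemma 4.2.1 (i): `brillNoetherLocus_subset_succ` ∕ `brillNoetherLocus_mono` (any field; `α_r(x) = α_{r+1}(x, P)`),
  **`brillNoetherLocus_eq_univ_of_dim_le`** (`W̃_r(P) = J` for `r ≥ dim J`), `brillNoetherLocus_ssubset_succ` (`r < dim J`).

Use (cell `hodgecm-mathlib`, D-0151; crux HLiu418 = stmt-HodgeConjecture-24832; Brill–Noether ∕ theta-divisor capital next to rows VI-7∕VI-8).  COUNT-NEUTRAL.
HC_CM is proved only modulo the 7 printed citations until rung 0 closes; this file moves no book by itself.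

## References
* [Lange2023AbelianVarietiesComplex] H. Lange, *Abelian Varieties over the Complex Numbers* (2023), §4.2.1 Lemma 4.2.1 (ii).
* [Milne1986JacobianVarieties] J. S. Milne, *Jacobian Varieties*, in Cornell–Silverman (1986), §5 (the maps `f^r : C^r → J`), Thm. 5.1 (a).
* [DeJong1996] A. J. de Jong, *Smoothness, semi-stability and alterations*, Publ. Math. IHÉS 83 (1996), 2.20, p. 61.
* [Hartshorne1977] R. Hartshorne, *Algebraic Geometry* (1977), II Example 3.2.6 (reduced induced structure).
-/

set_option autoImplicit false

noncomputable section

universe u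

open CategoryTheory AlgebraicGeometry Order TopologicalSpace Opposite

namespace Literature.AlgebraicGeometry.Motives

namespace Jacobian

open RelativeSpec Literature.AlgebraicGeometry.Resolution Literature.AlgebraicGeometry.Dimension Scheme.IdealSheafData

/-! ## §1 The alteration `C^r → W̃_r(P)` from `(r+s)`-fold uniqueness -/

section AnyField

variable {k : Type u} [Field k] [IsAlgClosed k] {C : SchemeOver k} [SmoothOfRelativeDimension 1 C.hom] [IsProper C.hom]
  [GeometricallyIntegral C.hom] (𝒥 : Jacobian C) (P : AlgPoints C k) (r s : ℕ) {n : ℕ} (hn : r + s = n)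

include hn in
/-- **The Abel sum map `α_r` lifts to an ALTERATION onto `W̃_r(P)` (reduced structure), granted `n`-fold uniqueness with `n = r + s`** (Milne §5:
`f^{(r)} : C^{(r)} → W^r` birational for `r ≤ g`; here «generically finite»): the `k`-point fibre of `α_r` over `w` injects, by `z ↦ (coords z) ⧺ ρ`, into
the fibre of `α_n` over `w · α_s(ρ)`, a single `𝔖_n`-orbit when `w · α_s(ρ)` lies in the open of `hopen`.
[cite: Milne1986JacobianVarieties, §5 (the maps f^r : C^r → J) and Thm. 5.1 (a)] [cite: Lange2023AbelianVarietiesComplex, §4.2.1 Lemma 4.2.1 (ii)]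
[cite: DeJong1996, 2.20, p. 61] -/
theorem exists_isAlteration_lift_abelSum_of_add
    (hopen : ∃ U₁ : 𝒥.J.X.left.Opens, (U₁ : Set 𝒥.J.X.left).Nonempty ∧
      ∀ a : 𝒥.J.Points k, a.pt ∈ U₁ → ∃ τ : Fin n → AlgPoints C k,
        (∏ j : Fin n, τ j ≫ 𝒥.abelJacobi P) = a ∧
        ∀ τ' : Fin n → AlgPoints C k, (∏ j : Fin n, τ' j ≫ 𝒥.abelJacobi P) = a →
          ∃ σ : Equiv.Perm (Fin n), τ' = τ ∘ σ) :
    ∃ φ : (powOverObj C.hom r).left ⟶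
        (vanishingIdeal (⟨𝒥.brillNoetherLocus P r, 𝒥.isClosed_brillNoetherLocus P r⟩ : Closeds 𝒥.J.X.left)).subscheme,
      φ ≫ (vanishingIdeal (⟨𝒥.brillNoetherLocus P r, 𝒥.isClosed_brillNoetherLocus P r⟩ : Closeds 𝒥.J.X.left)).subschemeι =
        (𝒥.abelSum P r).left ∧ IsAlteration φ := by
  classical
  subst hn
  haveI : IsIntegral (powOverObj C.hom r).left := (CurvePlaces.isIntegral_powOver_hom C r).1
  haveI : LocallyOfFiniteType 𝒥.J.X.hom := 𝒥.J.isProper.toLocallyOfFiniteType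
  set Z : Closeds 𝒥.J.X.left := ⟨𝒥.brillNoetherLocus P r, 𝒥.isClosed_brillNoetherLocus P r⟩ with hZdef
  set I := vanishingIdeal Z with hIdef
  set α := 𝒥.abelSum P r with hαdef
  -- the lift through the reduced closed subscheme on `W̃_r(P)`
  have hker : I.subschemeι.ker ≤ α.left.ker := by
    rw [ker_subschemeι, hIdef, hZdef, ← 𝒥.ker_abelSum_left_eq_vanishingIdeal P r]
  let φ : (powOverObj C.hom r).left ⟶ I.subscheme := IsClosedImmersion.lift I.subschemeι α.left hker
  have hφ : φ ≫ I.subschemeι = α.left := IsClosedImmersion.lift_fac _ _ _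
  refine ⟨φ, hφ, ?_⟩
  -- the target as a `k`-scheme and the lift as a `k`-morphism
  let W : SchemeOver k := Over.mk (I.subschemeι ≫ 𝒥.J.X.hom)
  let ιO : W ⟶ 𝒥.J.X := Over.homMk I.subschemeι rfl
  let ψ : powOverObj C.hom r ⟶ W := Over.homMk φ (by
    change φ ≫ I.subschemeι ≫ 𝒥.J.X.hom = (powOverObj C.hom r).hom
    rw [← Category.assoc, hφ]
    exact Over.w α)
  have hψι : ψ ≫ ιO = α := by
    ext1
    exact hφ
  -- instances: `W` integral and of finite type, `φ` proper
  haveI : IsIntegral W.left := isIntegral_subscheme_vanishingIdeal Z (𝒥.isIrreducible_brillNoetherLocus P r)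
  haveI : LocallyOfFiniteType W.hom := inferInstanceAs (LocallyOfFiniteType (I.subschemeι ≫ 𝒥.J.X.hom))
  haveI : IsProper (α.left ≫ 𝒥.J.X.hom) := by
    rw [Over.w α]
    exact isProper_powOver_base C.hom r
  haveI : IsProper α.left := IsProper.of_comp α.left 𝒥.J.X.hom
  haveI : IsProper (φ ≫ I.subschemeι) := by rw [hφ]; infer_instance
  haveI : IsProper φ := IsProper.of_comp φ I.subschemeι
  haveI : IsProper ψ.left := inferInstanceAs (IsProper φ)
  haveI : Mono I.subschemeι := ((IsClosedImmersion.iff_isFinite_and_mono I.subschemeι).mp inferInstance).2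
  haveI : Mono ιO.left := inferInstanceAs (Mono I.subschemeι)
  haveI : Mono ιO := Over.mono_of_mono_left ιO
  have hrange : Set.range I.subschemeι.base = 𝒥.brillNoetherLocus P r := range_subschemeι_vanishingIdeal Z
  -- `k`-points over `a ∈ W(k)` versus `k`-points of `C^r` with Abel sum `ι a`
  have hfibre : ∀ (a : AlgPoints W k) (z : AlgPoints (powOverObj C.hom r) k),
      AlgPoints.map ψ z = a ↔ z ≫ α = AlgPoints.map ιO a := by
    intro a z
    constructor
    · intro h
      change z ≫ ψ = a at h
      change z ≫ α = a ≫ ιO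
      rw [← h, Category.assoc, hψι]
    · intro h
      change z ≫ α = a ≫ ιO at h
      change z ≫ ψ = a
      rw [← hψι, ← Category.assoc] at h
      exact (cancel_mono ιO).mp h
  -- the open `U ⊆ W`: points `w` with `w · α_s(ρ)` in the open of `hopen` for some `s`-tuple `ρ`
  obtain ⟨U₁, hU₁, huniq⟩ := hopen
  let V' : 𝒥.J.X.left.Opens :=
    ⨆ ρ : Fin s → AlgPoints C k, (𝒥.J.translation (∏ j : Fin s, ρ j ≫ 𝒥.abelJacobi P)).left ⁻¹ᵁ U₁
  let U : W.left.Opens := I.subschemeι ⁻¹ᵁ V'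
  have hmemV' : ∀ x : 𝒥.J.Points k, x.pt ∈ V' ↔
      ∃ ρ : Fin s → AlgPoints C k, (x * ∏ j : Fin s, ρ j ≫ 𝒥.abelJacobi P).pt ∈ U₁ := by
    intro x
    simp only [V', Opens.mem_iSup]
    refine exists_congr fun ρ => ?_
    have hmap : AlgPoints.map (𝒥.J.translation (∏ j : Fin s, ρ j ≫ 𝒥.abelJacobi P)) x =
        x * ∏ j : Fin s, ρ j ≫ 𝒥.abelJacobi P :=
      (𝒥.J.comp_translation x _).trans (mul_comm _ _)
    change (𝒥.J.translation (∏ j : Fin s, ρ j ≫ 𝒥.abelJacobi P)).left.base x.pt ∈ U₁ ↔ _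
    rw [← AlgPoints.pt_map, hmap]
  refine AlgPoints.isAlteration_left_of_finite_nonempty_fibres ψ U ?_ ?_ ?_
  · -- `U` is non-empty: an `(r+s)`-fold Abel sum in `U₁` is `w · α_s(ρ)` with `w ∈ W̃_r(P)`
    haveI : JacobsonSpace 𝒥.J.X.left := LocallyOfFiniteType.jacobsonSpace 𝒥.J.X.hom
    obtain ⟨x₁, hx₁U, hx₁cl⟩ := nonempty_inter_closedPoints hU₁ U₁.2.isLocallyClosed
    obtain ⟨a₁, ha₁⟩ := AlgPoints.exists_pt_eq_of_isClosed_singleton (X := 𝒥.J.X) (mem_closedPoints_iff.mp hx₁cl)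
    obtain ⟨τ, hτ, -⟩ := huniq a₁ (ha₁ ▸ hx₁U)
    set w' : 𝒥.J.Points k := ∏ j : Fin r, τ (Fin.castAdd s j) ≫ 𝒥.abelJacobi P with hw'
    have hw'W : w'.pt ∈ 𝒥.brillNoetherLocus P r := (𝒥.pt_mem_brillNoetherLocus_iff P r w').mpr ⟨_, rfl⟩
    rw [← hrange] at hw'W
    obtain ⟨w, hw⟩ := hw'W
    refine ⟨w, ?_⟩
    change I.subschemeι.base w ∈ (V' : Set 𝒥.J.X.left)
    rw [hw]
    refine (hmemV' w').mpr ⟨fun j => τ (Fin.natAdd r j), ?_⟩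
    have hsplit : (∏ j : Fin r, τ (Fin.castAdd s j) ≫ 𝒥.abelJacobi P) * (∏ j : Fin s, τ (Fin.natAdd r j) ≫ 𝒥.abelJacobi P) =
        ∏ j : Fin (r + s), τ j ≫ 𝒥.abelJacobi P :=
      (Fin.prod_univ_add (fun j => τ j ≫ 𝒥.abelJacobi P)).symm
    rw [hw', hsplit, hτ, ha₁]
    exact hx₁U
  · -- finiteness of the `k`-point fibres over `U`
    intro a haU
    set x := AlgPoints.map ιO a with hx
    have hxV : x.pt ∈ V' := by
      rw [hx, AlgPoints.pt_map]
      exact haU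
    obtain ⟨ρ, hρ⟩ := (hmemV' x).mp hxV
    obtain ⟨τ₀, -, huniq₀⟩ := huniq (x * ∏ j : Fin s, ρ j ≫ 𝒥.abelJacobi P) hρ
    -- each `z` over `a` gives an `(r+s)`-tuple with Abel sum `x · α_s(ρ)`, hence a permutation of `τ₀`
    have key : ∀ z : {z : AlgPoints (powOverObj C.hom r) k | AlgPoints.map ψ z = a},
        ∃ σ : Equiv.Perm (Fin (r + s)),
          (Fin.append (fun j : Fin r => (z : AlgPoints (powOverObj C.hom r) k) ≫ (projOver C.hom r j : powOverObj C.hom r ⟶ C)) ρ :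
            Fin (r + s) → AlgPoints C k) = τ₀ ∘ σ := by
      rintro ⟨z, hz⟩
      apply huniq₀
      have hz' : z ≫ α = x := (hfibre a z).mp hz
      rw [hαdef, comp_abelSum_eq_prod] at hz'
      rw [Fin.prod_univ_add]
      simp only [Fin.append_left, Fin.append_right]
      exact congrArg (· * ∏ j : Fin s, ρ j ≫ 𝒥.abelJacobi P) hz'
    choose σ hσ using key
    have hinj : Function.Injective σ := by
      rintro ⟨z, hz⟩ ⟨z', hz'⟩ h
      have h1 := hσ ⟨z, hz⟩
      have h2 := hσ ⟨z', hz'⟩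
      rw [h, ← h2] at h1
      apply Subtype.ext
      refine hom_ext_projOver C.hom r z z' fun j => ?_
      have := congrFun h1 (Fin.castAdd s j)
      simp only [Fin.append_left] at this
      exact this
    exact Set.finite_coe_iff.mp (Finite.of_injective σ hinj)
  · -- non-emptiness of the `k`-point fibres (over all of `W`)
    intro a _
    set x := AlgPoints.map ιO a with hx
    have hxW : x.pt ∈ 𝒥.brillNoetherLocus P r := by
      rw [hx, AlgPoints.pt_map, ← hrange]
      exact ⟨a.pt, rfl⟩
    obtain ⟨τ, hτ⟩ := (𝒥.pt_mem_brillNoetherLocus_iff P r x).mp hxW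
    refine ⟨liftOver C.hom r τ, (hfibre a _).mpr ?_⟩
    rw [hαdef, liftOver_comp_abelSum, hτ]

include hn in
/-- **`dim W̃_r(P) = r`, granted `n`-fold uniqueness with `n = r + s`** (Lange Lemma 4.2.1 (ii), Milne §5 Thm. 5.1 (a)): `C^r → W̃_r(P)` is an
alteration (above), alterations preserve dimension (★ de Jong 2.20), `dim C^r = r`, and a closed immersion is a homeomorphism onto its range.
[cite: Lange2023AbelianVarietiesComplex, §4.2.1 Lemma 4.2.1 (ii)] [cite: Milne1986JacobianVarieties, §5 (the maps f^r : C^r → J) and Thm. 5.1 (a)]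
[cite: DeJong1996, 2.20, p. 61] -/
theorem topologicalKrullDim_brillNoetherLocus_of_hopen_add
    (hopen : ∃ U₁ : 𝒥.J.X.left.Opens, (U₁ : Set 𝒥.J.X.left).Nonempty ∧
      ∀ a : 𝒥.J.Points k, a.pt ∈ U₁ → ∃ τ : Fin n → AlgPoints C k,
        (∏ j : Fin n, τ j ≫ 𝒥.abelJacobi P) = a ∧
        ∀ τ' : Fin n → AlgPoints C k, (∏ j : Fin n, τ' j ≫ 𝒥.abelJacobi P) = a →
          ∃ σ : Equiv.Perm (Fin n), τ' = τ ∘ σ) :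
    topologicalKrullDim ↥(𝒥.brillNoetherLocus P r) = (r : WithBot ℕ∞) := by
  haveI : IsIntegral (powOverObj C.hom r).left := (CurvePlaces.isIntegral_powOver_hom C r).1
  haveI : LocallyOfFiniteType 𝒥.J.X.hom := 𝒥.J.isProper.toLocallyOfFiniteType
  set Z : Closeds 𝒥.J.X.left := ⟨𝒥.brillNoetherLocus P r, 𝒥.isClosed_brillNoetherLocus P r⟩ with hZdef
  obtain ⟨φ, -, hφ⟩ := 𝒥.exists_isAlteration_lift_abelSum_of_add P r s hn hopen
  haveI : IsIntegral (vanishingIdeal Z).subscheme := isIntegral_subscheme_vanishingIdeal Z (𝒥.isIrreducible_brillNoetherLocus P r)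
  haveI : LocallyOfFiniteType ((vanishingIdeal Z).subschemeι ≫ 𝒥.J.X.hom) := inferInstance
  have h1 := hφ.topologicalKrullDim_eq ((vanishingIdeal Z).subschemeι ≫ 𝒥.J.X.hom)
  haveI : SmoothOfRelativeDimension r (powOverObj C.hom r).hom := by
    have h := smoothOfRelativeDimension_powOver_base C.hom 1 r
    rw [Nat.mul_one] at h
    exact h
  have h2 : topologicalKrullDim (powOverObj C.hom r).left = r :=
    topologicalKrullDim_eq_of_smoothOfRelativeDimension (powOverObj C.hom r).hom r
  have hrange : Set.range (vanishingIdeal Z).subschemeι.base = 𝒥.brillNoetherLocus P r := range_subschemeι_vanishingIdeal Z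
  let e : ((vanishingIdeal Z).subscheme : Type u) ≃ₜ ↥(𝒥.brillNoetherLocus P r) :=
    (vanishingIdeal Z).subschemeι.isClosedEmbedding.isEmbedding.toHomeomorph.trans (Homeomorph.setCongr hrange)
  have h3 := IsHomeomorph.topologicalKrullDim_eq e e.isHomeomorph
  rw [← h3, ← h1, h2]

end AnyField

/-! ## §2 Complex Jacobians: Lange's Lemma 4.2.1 (ii) for every `r ≤ dim J` -/

/-- **Lange's Lemma 4.2.1 (ii): `dim W̃_r(P) = r` for every `r ≤ dim J`** (smooth projective complex curve, `dim J ≥ 1`, any base point `P`),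
UNCONDITIONALLY: apply §1 with `s := dim J − r` and the ★ `dim J`-fold uniqueness `exists_opens_general_abelSum_of_isSmoothProjective`.
[cite: Lange2023AbelianVarietiesComplex, §4.2.1 Lemma 4.2.1 (ii)] [cite: Milne1986JacobianVarieties, §5 (the maps f^r : C^r → J) and Thm. 5.1 (a)] -/
theorem topologicalKrullDim_brillNoetherLocus_eq_of_le {C : SchemeOver ℂ} [IsIntegral C.left] [IsLocallyNoetherian C.left] (𝒥 : Jacobian C)
    (hC : IsSmoothProjective 1 C) (hdim : 1 ≤ 𝒥.J.dim) (P : AlgPoints C ℂ) {r : ℕ} (hr : r ≤ 𝒥.J.dim) :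
    topologicalKrullDim ↥(𝒥.brillNoetherLocus P r) = (r : WithBot ℕ∞) := by
  haveI : SmoothOfRelativeDimension 1 C.hom := hC.smoothOfRelativeDimension
  haveI : IsProper C.hom := IsSmoothProjective.isProper_holds hC
  haveI : GeometricallyIntegral C.hom := IsSmoothProjective.geometricallyIntegral_holds hC
  obtain ⟨U₁, hU₁, h⟩ := 𝒥.exists_opens_general_abelSum_of_isSmoothProjective hC hdim P
  exact 𝒥.topologicalKrullDim_brillNoetherLocus_of_hopen_add P r (𝒥.J.dim - 1 + 1 - r) (n := 𝒥.J.dim - 1 + 1) (by omega)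
    ⟨U₁, hU₁, fun a ha => by
      obtain ⟨τ, -, hτ, hu⟩ := h a ha
      exact ⟨τ, hτ, hu⟩⟩

/-- `dim W̃_r(P) + (dim J − r) = dim J` for `r ≤ dim J`: the codimension of `W̃_r(P)` in `J` is `dim J − r`. [cite: Lange2023AbelianVarietiesComplex, §4.2.1 Lemma 4.2.1 (ii)] -/
theorem topologicalKrullDim_brillNoetherLocus_add_eq {C : SchemeOver ℂ} [IsIntegral C.left] [IsLocallyNoetherian C.left] (𝒥 : Jacobian C)
    (hC : IsSmoothProjective 1 C) (hdim : 1 ≤ 𝒥.J.dim) (P : AlgPoints C ℂ) {r : ℕ} (hr : r ≤ 𝒥.J.dim) :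
    topologicalKrullDim ↥(𝒥.brillNoetherLocus P r) + ((𝒥.J.dim - r : ℕ) : WithBot ℕ∞) = (𝒥.J.dim : WithBot ℕ∞) := by
  rw [𝒥.topologicalKrullDim_brillNoetherLocus_eq_of_le hC hdim P hr]
  norm_cast
  omega

/-! ## §3 (ed. 2) Lange's Lemma 4.2.1 (i): `W̃_r(P) ⊆ W̃_{r+1}(P)`, and `W̃_r(P) = J` for `r ≥ dim J` -/

section Monotone

open scoped MonObj

variable {k : Type u} [Field k] {C : SchemeOver k} (𝒥 : Jacobian C) (P : AlgPoints C k)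

/-- **`α_{rP}` factors through `α_{(r+1)P}` along `z ↦ (z, P)`**: the `(r+1)`-fold Abel sum of the tuple `(pr₀, …, pr_{r−1}, const P)` on `C^r` is the
`r`-fold Abel sum (`α_P(P) = 1`, ★ `point_comp_abelJacobi`). [cite: Milne1986JacobianVarieties, §5 (the maps f^r : C^r → J)] -/
theorem liftOver_snoc_comp_abelSum (r : ℕ) :
    liftOver C.hom (r + 1)
        (Fin.snoc (α := fun _ => (powOverObj C.hom r ⟶ C)) (fun j : Fin r => projOver C.hom r j)
          (toSpecOver (powOverObj C.hom r) ≫ P)) ≫ 𝒥.abelSum P (r + 1) = 𝒥.abelSum P r := by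
  rw [liftOver_comp_abelSum, Fin.prod_univ_castSucc]
  simp only [Fin.snoc_castSucc, Fin.snoc_last]
  rw [Category.assoc, point_comp_abelJacobi, MonObj.comp_one, mul_one]
  rfl

/-- **`W̃_r(P) ⊆ W̃_{r+1}(P)`** (Lange Lemma 4.2.1 (i): `W̃_n ⊆ W̃_{n+1}`, as `α_{r}(x) = α_{r+1}(x, P)`). [cite: Lange2023AbelianVarietiesComplex, §4.2.1 Lemma 4.2.1 (i)] -/
theorem brillNoetherLocus_subset_succ (r : ℕ) : 𝒥.brillNoetherLocus P r ⊆ 𝒥.brillNoetherLocus P (r + 1) := by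
  refine closure_mono (Set.range_subset_iff.mpr fun z => ?_)
  have h := congrArg (fun f : powOverObj C.hom r ⟶ 𝒥.J.X => f.left.base z) (𝒥.liftOver_snoc_comp_abelSum P r)
  simp only [Over.comp_left, Scheme.Hom.comp_base, TopCat.coe_comp, Function.comp_apply] at h
  exact ⟨_, h⟩

/-- `r ↦ W̃_r(P)` is monotone. [cite: Lange2023AbelianVarietiesComplex, §4.2.1 Lemma 4.2.1 (i)] -/
theorem brillNoetherLocus_mono : Monotone (𝒥.brillNoetherLocus P) :=
  monotone_nat_of_le_succ fun r => 𝒥.brillNoetherLocus_subset_succ P r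

end Monotone

/-- **Lange's Lemma 4.2.1 (i): `W̃_r(P) = J` for `r ≥ dim J`** (smooth projective complex curve, `dim J ≥ 1`): `W̃_{dim J}(P)` is a closed irreducible
subset of dimension `dim J` (§2) of the irreducible `J`, hence all of `J` (★ `Topology.topologicalKrullDim_lt_of_isClosed_ssubset`), and `W̃` is monotone.
[cite: Lange2023AbelianVarietiesComplex, §4.2.1 Lemma 4.2.1 (i)] [cite: Milne1986JacobianVarieties, §5 Thm. 5.1 (a)] -/
theorem brillNoetherLocus_eq_univ_of_dim_le {C : SchemeOver ℂ} [IsIntegral C.left] [IsLocallyNoetherian C.left] (𝒥 : Jacobian C)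
    (hC : IsSmoothProjective 1 C) (hdim : 1 ≤ 𝒥.J.dim) (P : AlgPoints C ℂ) {r : ℕ} (hr : 𝒥.J.dim ≤ r) :
    𝒥.brillNoetherLocus P r = Set.univ := by
  refine Set.eq_univ_of_univ_subset ((Set.univ_subset_iff.mpr ?_).trans (𝒥.brillNoetherLocus_mono P hr))
  by_contra hne
  have hlt := Literature.Topology.topologicalKrullDim_lt_of_isClosed_ssubset (X := 𝒥.J.X.left)
    (𝒥.isClosed_brillNoetherLocus P 𝒥.J.dim) hne 𝒥.J.dim (by
      rw [𝒥.J.topologicalKrullDim_left]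
      exact_mod_cast Nat.lt_succ_self _)
  rw [𝒥.topologicalKrullDim_brillNoetherLocus_eq_of_le hC hdim P le_rfl] at hlt
  exact lt_irrefl _ hlt

/-- **`W̃_r(P) ⊊ W̃_{r+1}(P)` for `r < dim J`** (their dimensions are `r` and `r + 1`, §2). [cite: Lange2023AbelianVarietiesComplex, §4.2.1 Lemma 4.2.1 (i) and (ii)] -/
theorem brillNoetherLocus_ssubset_succ {C : SchemeOver ℂ} [IsIntegral C.left] [IsLocallyNoetherian C.left] (𝒥 : Jacobian C)
    (hC : IsSmoothProjective 1 C) (hdim : 1 ≤ 𝒥.J.dim) (P : AlgPoints C ℂ) {r : ℕ} (hr : r < 𝒥.J.dim) :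
    𝒥.brillNoetherLocus P r ⊂ 𝒥.brillNoetherLocus P (r + 1) := by
  refine (𝒥.brillNoetherLocus_subset_succ P r).ssubset_of_ne fun heq => ?_
  have h1 := 𝒥.topologicalKrullDim_brillNoetherLocus_eq_of_le hC hdim P hr.le
  have h2 := 𝒥.topologicalKrullDim_brillNoetherLocus_eq_of_le hC hdim P (Nat.succ_le_of_lt hr)
  rw [← heq, h1] at h2
  have : r = r + 1 := by exact_mod_cast h2
  omega

end Jacobian

end Literature.AlgebraicGeometry.Motives

end
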